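import Summits.QuantumFields.YangMills.Theorems.UnitScaleTiltProp7CovariantLocalMinimality
import HarnessLib

/-!
# Route `UnitScaleTilt`, crux K1 child «MinimiserStabilityRegPr» (stmt-QuantumFields-19200), leaf V3 «Prop 7 from a background (14)», line «blend-l2» —
# THE EXACT PLAQUETTE IDENTITY AT A BACKGROUND (no Taylor remainder, no sup hypothesis), PART 1: ALGEBRA AND THE PER-PLAQUETTE FORM

Cell `ym3-torus` ∕ fleet seat `ym-ust-19200-p1` (gen 10; HUMAN RULING D-0037, YM ladder rung R3).  WHY.  The assembled uniqueness schema of the line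
(`Prop7BlendClause1.atMostOneCriticalOrbit_of_reprSchema_T3`, gen 9) goes through gen 2's per-plaquette TAYLOR expansion with the curl factor
(`Prop7CovariantCoercivity.quarter_hs_plaq_expansion_ge`): its remainder `(2a² + 128s² + 8a)·Σ_{b∈∂p}‖Y_b‖²` carries the SUP norm `s` of the representative,
so the growth constant `κ = (1/(16C_P))L^{−2(K−n)} − 12(2a² + 128s² + 8a) − C_L` is positive only when `s ≲ L^{−(K−n)}/√C_P` — which is what made the sup bound
S1 (`Prop7BlendedGauge`, `s = O(ε₀)L^{−(K−n)}`) load-bearing in the assembly and what excludes representatives whose sup is only `O(ε₀)` (the `ℓ²`-optimal chart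
of gen 6 with its `O(ε₀)` point charges at the k-centres, NUMERICS-19200-C4 g6/g7).  THIS FILE REMOVES THE TAYLOR STEP.  For unitary `P₀` (background plaquette)
and any `Pl` (competitor plaquette), with the RELATIVE plaquette variable `R = Pl·P₀^*`,
  `Σ|(Pl − 1)_jk|² = Σ|(P₀ − 1)_jk|² + 2Re Tr((P₀ − 1)^*·(R − 1)·P₀) + Σ|(R − 1)_jk|²`
EXACTLY (`sum_norm_sq_sub_one_eq`: polarisation of `Pl − 1 = (P₀ − 1) + (R − 1)P₀`).  On the lattice (`quarter_hs_plaq_eq`, any `SU(N)`):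
`¼|U(∂p) − 1|²_HS = ¼|U₀(∂p) − 1|²_HS + ½Re Tr((U₀(∂p) − 1)^*(R_p − 1)U₀(∂p)) + ¼|R_p − 1|²_HS`, `R_p = U(∂p)U₀(∂p)^*`, with NO remainder and NO hypothesis.
The middle term differs from gen 2's exact first-order functional `½Re Tr((U₀(∂p)−1)^* L_p(Y) U₀(∂p))` (linear in `Y_b = U_bU₀,b^* − 1`) by the pairing of
`U₀(∂p) − 1` with the second-order remainder `r_p = R_p − 1 − L_p(Y)`, and `‖r_p‖ ≤ 2(Σ_{b∈∂p}‖Y_b‖)²` holds for ALL unitary fluctuations — gen 2's lemma needs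
`‖Y_b‖ ≤ 1` on two bonds, here removed (`norm_prod_sub_one_sub_lin_le`: a free-ring identity for the four-factor word plus `‖u − 1‖ ≤ 2`).  Hence per plaquette
(`half_re_trace_rel_ge_lin`, `SU(2)`, `‖U₀(∂p) − 1‖ ≤ a`): `½Re Tr((U₀(∂p)−1)^*(R_p−1)U₀(∂p)) ≥ Lin_p(Y) − 8a·Σ_{b∈∂p}‖Y_b‖²`.  The summed identity, the
sup-free growth inequality from a RELATIVE-CURVATURE Poincaré inequality and the re-assembled clause-1 schema are Part 2 (`UnitScaleTiltProp7ExactClause1`).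
REMARK.  `‖R_p − 1‖ ≤ dist1 U(∂p) + dist1 U₀(∂p)` (`norm_relPlaq_sub_one_le`): on `(6)(ε)` the relative plaquette field is `≤ 2εL^{−2(K−n)}` whatever the
representative — the reason no sup norm is needed once the expansion is organised around `R_p`.

WHAT IS PROVED (sorry-free, no definition).  §1 `sum_norm_sq_sub_one_eq`, `word4_sub_one_sub_lin_eq`, `remainder_poly_le`, `norm_remainder5_le`,
**`norm_prod_sub_one_sub_lin_le`**, `norm_plaq_mul_star_bg_sub_one_sub_lin_le'`, `abs_half_re_trace_sub_le`; §2 **`quarter_hs_plaq_eq`**,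
`norm_plaqHol_mul_star_bg_sub_one_sub_lin_le'`, `norm_relPlaq_sub_one_le`, **`half_re_trace_rel_ge_lin`**.

HONEST SCOPE.  Matrix algebra over the tree's letters (gen 2's `Prop7CovariantCoercivity` toolkit); nothing of [Balaban1985Variational] is asserted; count-neutral
helper toward stmt-QuantumFields-19200 (`--supports`).  Not a claim about the continuum limit or the mass gap.

References: T. Bałaban, CMP 102 (1985) 277–309 [Balaban1985Variational] ((22)–(31) pp.281–283); CMP 99 (1985) 389–434 [Balaban1985BackgroundPropagators]
((3.1)–(3.4) pp.390–391); CMP 109 (1987) 249–301 [Balaban1987RG1] ((0.14) p.254).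
-/

noncomputable section

open scoped BigOperators Matrix.Norms.L2Operator Matrix

namespace Summit.QuantumFields.YangMills.Theorems.Prop7ExactExpansion

open Literature.MathematicalPhysics.QuantumFieldTheory.Balaban1983to89
open Finset
open Summit.QuantumFields.YangMills.Theorems.Prop7CovariantCoercivity (sum_norm_sq_add_eq sum_norm_sq_mul_unitary abs_re_trace_le
  plaqHol_eq_word coe_mul_inv_sub_one coe_conj_sub_one norm_coe_conj_sub_one plaq_mul_background)

/-! ## §1 Algebra: the exact polarisation at a unitary background and the unconditional second-order remainder -/

section Algebra

variable {N : ℕ}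

/-- **THE EXACT HILBERT–SCHMIDT IDENTITY AT A UNITARY BACKGROUND**: for `P₀` unitary and any `Pl`, with `R = Pl·P₀^*`,
`Σ|(Pl − 1)_jk|² = Σ|(P₀ − 1)_jk|² + 2Re Tr((P₀ − 1)^*·(R − 1)P₀) + Σ|(R − 1)_jk|²` — polarisation of `Pl − 1 = (P₀ − 1) + (R − 1)P₀`; no remainder.
[cite: Balaban1985Variational, (26)-(31) pp.282-283] -/
theorem sum_norm_sq_sub_one_eq (Pl P₀ : Matrix (Fin N) (Fin N) ℂ) (hP : P₀ ∈ Matrix.unitaryGroup (Fin N) ℂ) :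
    ∑ j : Fin N, ∑ k : Fin N, ‖(Pl - 1) j k‖ ^ 2
      = ∑ j : Fin N, ∑ k : Fin N, ‖(P₀ - 1) j k‖ ^ 2 + 2 * (((P₀ - 1)ᴴ * ((Pl * star P₀ - 1) * P₀)).trace).re
        + ∑ j : Fin N, ∑ k : Fin N, ‖(Pl * star P₀ - 1) j k‖ ^ 2 := by
  have hPP : star P₀ * P₀ = 1 := Matrix.mem_unitaryGroup_iff'.mp hP
  have hX : Pl - 1 = (P₀ - 1) + (Pl * star P₀ - 1) * P₀ := by
    rw [sub_mul, mul_assoc, hPP, mul_one, one_mul]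
    abel
  rw [hX, sum_norm_sq_add_eq, sum_norm_sq_mul_unitary _ hP]

/-- The free-ring identity behind the second-order remainder of a four-factor word (`s₃, s₄` stand for `u₃^*, u₄^*`). [folklore] -/
theorem word4_sub_one_sub_lin_eq {R : Type*} [Ring R] (u₁ u₂ u₃ u₄ s₃ s₄ : R) :
    u₁ * u₂ * s₃ * s₄ - 1 - ((u₁ - 1) + (u₂ - 1) - (u₃ - 1) - (u₄ - 1))
      = (u₁ - 1) * (u₂ - 1) + (s₃ - 1) * (s₄ - 1)
        + ((u₁ - 1) + (u₂ - 1) + (u₁ - 1) * (u₂ - 1)) * ((s₃ - 1) + (s₄ - 1) + (s₃ - 1) * (s₄ - 1))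
        + ((u₃ - 1) + (s₃ - 1)) + ((u₄ - 1) + (s₄ - 1)) := by
  noncomm_ring

/-- The polynomial bookkeeping on `[0, 2]⁴`: `y₁y₂ + y₃y₄ + (y₁+y₂+y₁y₂)(y₃+y₄+y₃y₄) + y₃² + y₄² ≤ 2(Σy_i)²`. [folklore] -/
theorem remainder_poly_le {y₁ y₂ y₃ y₄ : ℝ} (n₁ : 0 ≤ y₁) (n₂ : 0 ≤ y₂) (n₃ : 0 ≤ y₃) (n₄ : 0 ≤ y₄)
    (b₁ : y₁ ≤ 2) (b₂ : y₂ ≤ 2) (b₃ : y₃ ≤ 2) (b₄ : y₄ ≤ 2) :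
    y₁ * y₂ + y₃ * y₄ + (y₁ + y₂ + y₁ * y₂) * (y₃ + y₄ + y₃ * y₄) + y₃ * y₃ + y₄ * y₄ ≤ 2 * (y₁ + y₂ + y₃ + y₄) ^ 2 := by
  have p12 : y₁ * y₂ ≤ y₁ + y₂ := by nlinarith
  have p34 : y₃ * y₄ ≤ y₃ + y₄ := by nlinarith
  have a1 : y₁ + y₂ + y₁ * y₂ ≤ 2 * (y₁ + y₂) := by linarith
  have a2 : y₃ + y₄ + y₃ * y₄ ≤ 2 * (y₃ + y₄) := by linarith
  have q3 : (y₁ + y₂ + y₁ * y₂) * (y₃ + y₄ + y₃ * y₄) ≤ (2 * (y₁ + y₂)) * (2 * (y₃ + y₄)) :=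
    mul_le_mul a1 a2 (by positivity) (by positivity)
  nlinarith [mul_nonneg n₁ n₂, mul_nonneg n₃ n₄, mul_nonneg n₁ n₁, mul_nonneg n₂ n₂, mul_nonneg n₃ n₃, mul_nonneg n₄ n₄, q3]

/-- Norm bookkeeping for the five-term remainder (abstract letters; `C, D` are `u₃^* − 1, u₄^* − 1`, `C', D'` are `u₃ − 1, u₄ − 1`). [folklore] -/
theorem norm_remainder5_le {n : Type*} [Fintype n] [DecidableEq n] (A B C D C' D' : Matrix n n ℂ)
    (nC : ‖C‖ = ‖C'‖) (nD : ‖D‖ = ‖D'‖) (t4 : ‖C' + C‖ ≤ ‖C'‖ * ‖C'‖) (t5 : ‖D' + D‖ ≤ ‖D'‖ * ‖D'‖)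
    (bA : ‖A‖ ≤ 2) (bB : ‖B‖ ≤ 2) (bC : ‖C'‖ ≤ 2) (bD : ‖D'‖ ≤ 2) :
    ‖A * B + C * D + (A + B + A * B) * (C + D + C * D) + (C' + C) + (D' + D)‖ ≤ 2 * (‖A‖ + ‖B‖ + ‖C'‖ + ‖D'‖) ^ 2 := by
  have t1 : ‖A * B‖ ≤ ‖A‖ * ‖B‖ := norm_mul_le _ _
  have t2 : ‖C * D‖ ≤ ‖C'‖ * ‖D'‖ := by rw [← nC, ← nD]; exact norm_mul_le _ _
  have t3a : ‖A + B + A * B‖ ≤ ‖A‖ + ‖B‖ + ‖A‖ * ‖B‖ := (norm_add_le _ _).trans (add_le_add (norm_add_le _ _) (norm_mul_le _ _))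
  have t3b : ‖C + D + C * D‖ ≤ ‖C'‖ + ‖D'‖ + ‖C'‖ * ‖D'‖ := by
    rw [← nC, ← nD]; exact (norm_add_le _ _).trans (add_le_add (norm_add_le _ _) (norm_mul_le _ _))
  have t3 : ‖(A + B + A * B) * (C + D + C * D)‖ ≤ (‖A‖ + ‖B‖ + ‖A‖ * ‖B‖) * (‖C'‖ + ‖D'‖ + ‖C'‖ * ‖D'‖) :=
    (norm_mul_le _ _).trans (mul_le_mul t3a t3b (norm_nonneg _) (by positivity))
  have s1 : ‖A * B + C * D + (A + B + A * B) * (C + D + C * D) + (C' + C) + (D' + D)‖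
      ≤ ‖A * B‖ + ‖C * D‖ + ‖(A + B + A * B) * (C + D + C * D)‖ + ‖C' + C‖ + ‖D' + D‖ := by
    refine (norm_add_le _ _).trans (add_le_add ?_ le_rfl)
    refine (norm_add_le _ _).trans (add_le_add ?_ le_rfl)
    refine (norm_add_le _ _).trans (add_le_add ?_ le_rfl)
    exact norm_add_le _ _
  refine s1.trans ((add_le_add (add_le_add (add_le_add (add_le_add t1 t2) t3) t4) t5).trans ?_)
  exact remainder_poly_le (norm_nonneg _) (norm_nonneg _) (norm_nonneg _) (norm_nonneg _) bA bB bC bD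

/-- **THE SECOND-ORDER REMAINDER OF A FOUR-FACTOR UNITARY WORD, UNCONDITIONALLY**: for unitary `u₁, u₂, u₃, u₄`,
`‖u₁u₂u₃^*u₄^* − 1 − ((u₁−1) + (u₂−1) − (u₃−1) − (u₄−1))‖ ≤ 2(Σ_i‖u_i − 1‖)²` — a free-ring identity plus `‖u_i − 1‖ ≤ 2`; no `‖u_i − 1‖ ≤ 1` needed
(compare `Prop7FlatExpansion.norm_plaq_sub_one_sub_lin_le`). [cite: Balaban1985Variational, (22)-(26) pp.281-282] -/
theorem norm_prod_sub_one_sub_lin_le {n : Type*} [Fintype n] [DecidableEq n] {u₁ u₂ u₃ u₄ : Matrix n n ℂ}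
    (h₁ : u₁ ∈ Matrix.unitaryGroup n ℂ) (h₂ : u₂ ∈ Matrix.unitaryGroup n ℂ) (h₃ : u₃ ∈ Matrix.unitaryGroup n ℂ)
    (h₄ : u₄ ∈ Matrix.unitaryGroup n ℂ) :
    ‖u₁ * u₂ * star u₃ * star u₄ - 1 - ((u₁ - 1) + (u₂ - 1) - (u₃ - 1) - (u₄ - 1))‖
      ≤ 2 * (‖u₁ - 1‖ + ‖u₂ - 1‖ + ‖u₃ - 1‖ + ‖u₄ - 1‖) ^ 2 := by
  rw [word4_sub_one_sub_lin_eq u₁ u₂ u₃ u₄ (star u₃) (star u₄)]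
  -- `(u − 1) + (u^* − 1) = −(u − 1)(u^* − 1)` for unitary `u`
  have hq : ∀ u : Matrix n n ℂ, u ∈ Matrix.unitaryGroup n ℂ → (u - 1) + (star u - 1) = -((u - 1) * (star u - 1)) := by
    intro u hu
    have huu : u * star u = 1 := Matrix.mem_unitaryGroup_iff.mp hu
    rw [sub_mul, mul_sub, huu, one_mul, mul_one]
    abel
  have hs : ∀ u : Matrix n n ℂ, ‖star u - 1‖ = ‖u - 1‖ := fun u => by
    rw [← norm_star (star u - 1), star_sub, star_star, star_one]
  have ht : ∀ u : Matrix n n ℂ, u ∈ Matrix.unitaryGroup n ℂ → ‖(u - 1) + (star u - 1)‖ ≤ ‖u - 1‖ * ‖u - 1‖ := by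
    intro u hu
    rw [hq u hu, norm_neg]
    exact (norm_mul_le _ _).trans (le_of_eq (by rw [hs]))
  -- `‖u − 1‖ ≤ 2`
  have h2 : ∀ u : Matrix n n ℂ, u ∈ Matrix.unitaryGroup n ℂ → ‖u - 1‖ ≤ 2 := by
    intro u hu
    rcases isEmpty_or_nonempty n with hn | hn
    · have : u - 1 = 0 := Subsingleton.elim _ _
      rw [this, norm_zero]; norm_num
    · calc ‖u - 1‖ ≤ ‖u‖ + ‖(1 : Matrix n n ℂ)‖ := norm_sub_le _ _
        _ = 2 := by rw [CStarRing.norm_of_mem_unitary hu, CStarRing.norm_one]; norm_num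
  exact norm_remainder5_le (u₁ - 1) (u₂ - 1) (star u₃ - 1) (star u₄ - 1) (u₃ - 1) (u₄ - 1) (hs u₃) (hs u₄) (ht u₃ h₃) (ht u₄ h₄)
    (h2 u₁ h₁) (h2 u₂ h₂) (h2 u₃ h₃) (h2 u₄ h₄)

/-- **GEN 2'S TRANSPORTED REMAINDER WITHOUT THE `≤ 1` HYPOTHESES**: for special unitaries `W_i` (fluctuations) and `V_i` (background links) with
`P₀ = V₁V₂V₃⁻¹V₄⁻¹`, `Q = V₁V₂V₃⁻¹`: `‖(W₁V₁)(W₂V₂)(W₃V₃)⁻¹(W₄V₄)⁻¹·P₀^* − 1 − (Y₁ + V₁Y₂V₁^* − QY₃Q^* − P₀Y₄P₀^*)‖ ≤ 2(Σ_i‖Y_i‖)²`, `Y_i = W_i − 1`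
(twin of `Prop7CovariantCoercivity.norm_plaq_mul_star_bg_sub_one_sub_lin_le`). [cite: Balaban1985Variational, (22)-(26) pp.281-282] -/
theorem norm_plaq_mul_star_bg_sub_one_sub_lin_le' {n : Type*} [Fintype n] [DecidableEq n] (W₁ W₂ W₃ W₄ V₁ V₂ V₃ V₄ : Matrix.specialUnitaryGroup n ℂ) :
    ‖(((W₁ * V₁) * (W₂ * V₂) * (W₃ * V₃)⁻¹ * (W₄ * V₄)⁻¹ : Matrix.specialUnitaryGroup n ℂ) : Matrix n n ℂ)
          * star ((V₁ * V₂ * V₃⁻¹ * V₄⁻¹ : Matrix.specialUnitaryGroup n ℂ) : Matrix n n ℂ) - 1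
        - (((W₁ : Matrix n n ℂ) - 1)
            + (V₁ : Matrix n n ℂ) * ((W₂ : Matrix n n ℂ) - 1) * star (V₁ : Matrix n n ℂ)
            - ((V₁ * V₂ * V₃⁻¹ : Matrix.specialUnitaryGroup n ℂ) : Matrix n n ℂ) * ((W₃ : Matrix n n ℂ) - 1)
                * star ((V₁ * V₂ * V₃⁻¹ : Matrix.specialUnitaryGroup n ℂ) : Matrix n n ℂ)
            - ((V₁ * V₂ * V₃⁻¹ * V₄⁻¹ : Matrix.specialUnitaryGroup n ℂ) : Matrix n n ℂ) * ((W₄ : Matrix n n ℂ) - 1)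
                * star ((V₁ * V₂ * V₃⁻¹ * V₄⁻¹ : Matrix.specialUnitaryGroup n ℂ) : Matrix n n ℂ))‖
      ≤ 2 * (‖(W₁ : Matrix n n ℂ) - 1‖ + ‖(W₂ : Matrix n n ℂ) - 1‖ + ‖(W₃ : Matrix n n ℂ) - 1‖ + ‖(W₄ : Matrix n n ℂ) - 1‖) ^ 2 := by
  set Q : Matrix.specialUnitaryGroup n ℂ := V₁ * V₂ * V₃⁻¹ with hQ
  set P₀ : Matrix.specialUnitaryGroup n ℂ := V₁ * V₂ * V₃⁻¹ * V₄⁻¹ with hP₀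
  set U₂ : Matrix.specialUnitaryGroup n ℂ := V₁ * W₂ * V₁⁻¹ with hU₂
  set U₃ : Matrix.specialUnitaryGroup n ℂ := Q * W₃ * Q⁻¹ with hU₃
  set U₄ : Matrix.specialUnitaryGroup n ℂ := P₀ * W₄ * P₀⁻¹ with hU₄
  have hgrp : (W₁ * V₁) * (W₂ * V₂) * (W₃ * V₃)⁻¹ * (W₄ * V₄)⁻¹ = (W₁ * U₂ * U₃⁻¹ * U₄⁻¹) * P₀ := by
    rw [hU₂, hU₃, hU₄, hQ, hP₀]; exact plaq_mul_background W₁ W₂ W₃ W₄ V₁ V₂ V₃ V₄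
  have hmat : (((W₁ * V₁) * (W₂ * V₂) * (W₃ * V₃)⁻¹ * (W₄ * V₄)⁻¹ : Matrix.specialUnitaryGroup n ℂ) : Matrix n n ℂ) * star (P₀ : Matrix n n ℂ)
      = (W₁ : Matrix n n ℂ) * (U₂ : Matrix n n ℂ) * star (U₃ : Matrix n n ℂ) * star (U₄ : Matrix n n ℂ) := by
    rw [hgrp]
    have hP : (P₀ : Matrix n n ℂ) * star (P₀ : Matrix n n ℂ) = 1 := Matrix.mem_unitaryGroup_iff.mp P₀.2.1
    simp only [Submonoid.coe_mul]
    rw [show ((U₃⁻¹ : Matrix.specialUnitaryGroup n ℂ) : Matrix n n ℂ) = star (U₃ : Matrix n n ℂ) from rfl,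
      show ((U₄⁻¹ : Matrix.specialUnitaryGroup n ℂ) : Matrix n n ℂ) = star (U₄ : Matrix n n ℂ) from rfl, mul_assoc _ (P₀ : Matrix n n ℂ), hP, mul_one]
  rw [hmat]
  have e₂ : (V₁ : Matrix n n ℂ) * ((W₂ : Matrix n n ℂ) - 1) * star (V₁ : Matrix n n ℂ) = (U₂ : Matrix n n ℂ) - 1 := (coe_conj_sub_one V₁ W₂).symm
  have e₃ : (Q : Matrix n n ℂ) * ((W₃ : Matrix n n ℂ) - 1) * star (Q : Matrix n n ℂ) = (U₃ : Matrix n n ℂ) - 1 := (coe_conj_sub_one Q W₃).symm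
  have e₄ : (P₀ : Matrix n n ℂ) * ((W₄ : Matrix n n ℂ) - 1) * star (P₀ : Matrix n n ℂ) = (U₄ : Matrix n n ℂ) - 1 := (coe_conj_sub_one P₀ W₄).symm
  rw [e₂, e₃, e₄]
  have n₂ : ‖(U₂ : Matrix n n ℂ) - 1‖ = ‖(W₂ : Matrix n n ℂ) - 1‖ := norm_coe_conj_sub_one V₁ W₂
  have n₃ : ‖(U₃ : Matrix n n ℂ) - 1‖ = ‖(W₃ : Matrix n n ℂ) - 1‖ := norm_coe_conj_sub_one Q W₃
  have n₄ : ‖(U₄ : Matrix n n ℂ) - 1‖ = ‖(W₄ : Matrix n n ℂ) - 1‖ := norm_coe_conj_sub_one P₀ W₄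
  have h := norm_prod_sub_one_sub_lin_le W₁.2.1 U₂.2.1 U₃.2.1 U₄.2.1
  rw [n₂, n₃, n₄] at h
  exact h

/-- `|½Re Tr((P₀ − 1)^*·X·P₀) − ½Re Tr((P₀ − 1)^*·X′·P₀)| ≤ ‖P₀ − 1‖·‖X − X′‖` for unitary `P₀ ∈ M₂(ℂ)` (`|Re Tr M| ≤ 2‖M‖`). [folklore] -/
theorem abs_half_re_trace_sub_le (P₀ X X' : Matrix (Fin 2) (Fin 2) ℂ) (hP : P₀ ∈ Matrix.unitaryGroup (Fin 2) ℂ) :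
    |(1 / 2) * (((P₀ - 1)ᴴ * (X * P₀)).trace).re - (1 / 2) * (((P₀ - 1)ᴴ * (X' * P₀)).trace).re| ≤ ‖P₀ - 1‖ * ‖X - X'‖ := by
  have e : (1 / 2) * (((P₀ - 1)ᴴ * (X * P₀)).trace).re - (1 / 2) * (((P₀ - 1)ᴴ * (X' * P₀)).trace).re
      = (1 / 2) * (((P₀ - 1)ᴴ * ((X - X') * P₀)).trace).re := by
    rw [← mul_sub, ← Complex.sub_re, ← Matrix.trace_sub, ← Matrix.mul_sub, sub_mul]
  rw [e, abs_mul, abs_of_pos (by norm_num : (0 : ℝ) < 1 / 2)]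
  have h := abs_re_trace_le ((P₀ - 1)ᴴ * ((X - X') * P₀))
  have hn : ‖(P₀ - 1)ᴴ * ((X - X') * P₀)‖ ≤ ‖P₀ - 1‖ * ‖X - X'‖ := by
    refine (norm_mul_le _ _).trans (le_of_eq ?_)
    rw [← Matrix.star_eq_conjTranspose, norm_star, CStarRing.norm_mul_mem_unitary _ hP]
  have : ((2 : ℕ) : ℝ) = 2 := by norm_num
  rw [this] at h
  nlinarith [h, hn, norm_nonneg (P₀ - 1), norm_nonneg (X - X')]

end Algebra

/-! ## §2 On the lattice, per plaquette -/

section Lattice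

variable {P : Params} {j : ℕ} {N : ℕ} [NeZero N]

/-- **THE EXACT IDENTITY PER PLAQUETTE ON THE LATTICE** (`SU(N)`): with `R_p = U(∂p)U₀(∂p)^*`,
`¼Σ|(U(∂p) − 1)_jk|² = ¼Σ|(U₀(∂p) − 1)_jk|² + ½Re Tr((U₀(∂p) − 1)^*(R_p − 1)U₀(∂p)) + ¼Σ|(R_p − 1)_jk|²`. [cite: Balaban1985Variational, (26)-(31) pp.282-283] -/
theorem quarter_hs_plaq_eq (U U₀ : GaugeField P j (Matrix.specialUnitaryGroup (Fin N) ℂ)) (p : Plaq P j) :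
    (1 / 4) * ∑ i₁ : Fin N, ∑ i₂ : Fin N, ‖(((GaugeField.plaqHol U p : Matrix.specialUnitaryGroup (Fin N) ℂ) : Matrix (Fin N) (Fin N) ℂ) - 1) i₁ i₂‖ ^ 2
      = (1 / 4) * ∑ i₁ : Fin N, ∑ i₂ : Fin N, ‖(((GaugeField.plaqHol U₀ p : Matrix.specialUnitaryGroup (Fin N) ℂ) : Matrix (Fin N) (Fin N) ℂ) - 1) i₁ i₂‖ ^ 2
        + (1 / 2) * ((((((GaugeField.plaqHol U₀ p : Matrix.specialUnitaryGroup (Fin N) ℂ) : Matrix (Fin N) (Fin N) ℂ)) - 1)ᴴ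
            * ((((GaugeField.plaqHol U p : Matrix.specialUnitaryGroup (Fin N) ℂ) : Matrix (Fin N) (Fin N) ℂ)
                  * star ((GaugeField.plaqHol U₀ p : Matrix.specialUnitaryGroup (Fin N) ℂ) : Matrix (Fin N) (Fin N) ℂ) - 1)
                * ((GaugeField.plaqHol U₀ p : Matrix.specialUnitaryGroup (Fin N) ℂ) : Matrix (Fin N) (Fin N) ℂ))).trace).re
        + (1 / 4) * ∑ i₁ : Fin N, ∑ i₂ : Fin N, ‖(((GaugeField.plaqHol U p : Matrix.specialUnitaryGroup (Fin N) ℂ) : Matrix (Fin N) (Fin N) ℂ)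
            * star ((GaugeField.plaqHol U₀ p : Matrix.specialUnitaryGroup (Fin N) ℂ) : Matrix (Fin N) (Fin N) ℂ) - 1) i₁ i₂‖ ^ 2 := by
  rw [sum_norm_sq_sub_one_eq _ _ (GaugeField.plaqHol U₀ p).2.1]
  ring

/-- Gen 2's exact-linear-part remainder on the lattice WITHOUT the `‖Y‖ ≤ 1` hypotheses: `‖U(∂p)U₀(∂p)^* − 1 − L_p(Y)‖ ≤ 2(Σ_{b∈∂p}‖Y(b)‖)²`,
`Y(b) = U(b)U₀(b)^* − 1`, `L_p` the transported linear part. [cite: Balaban1985Variational, (22)-(26) pp.281-282] -/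
theorem norm_plaqHol_mul_star_bg_sub_one_sub_lin_le' (U U₀ : GaugeField P j (Matrix.specialUnitaryGroup (Fin N) ℂ)) (p : Plaq P j) :
    ‖((GaugeField.plaqHol U p : Matrix.specialUnitaryGroup (Fin N) ℂ) : Matrix (Fin N) (Fin N) ℂ)
          * star ((GaugeField.plaqHol U₀ p : Matrix.specialUnitaryGroup (Fin N) ℂ) : Matrix (Fin N) (Fin N) ℂ) - 1
        - (((U ⟨p.src, p.μ⟩ : Matrix (Fin N) (Fin N) ℂ) * star (U₀ ⟨p.src, p.μ⟩ : Matrix (Fin N) (Fin N) ℂ) - 1)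
            + (U₀ ⟨p.src, p.μ⟩ : Matrix (Fin N) (Fin N) ℂ)
                * ((U ⟨p.src.shift p.μ, p.ν⟩ : Matrix (Fin N) (Fin N) ℂ) * star (U₀ ⟨p.src.shift p.μ, p.ν⟩ : Matrix (Fin N) (Fin N) ℂ) - 1)
                * star (U₀ ⟨p.src, p.μ⟩ : Matrix (Fin N) (Fin N) ℂ)
            - ((U₀ ⟨p.src, p.μ⟩ * U₀ ⟨p.src.shift p.μ, p.ν⟩ * (U₀ ⟨p.src.shift p.ν, p.μ⟩)⁻¹ : Matrix.specialUnitaryGroup (Fin N) ℂ) : Matrix (Fin N) (Fin N) ℂ)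
                * ((U ⟨p.src.shift p.ν, p.μ⟩ : Matrix (Fin N) (Fin N) ℂ) * star (U₀ ⟨p.src.shift p.ν, p.μ⟩ : Matrix (Fin N) (Fin N) ℂ) - 1)
                * star ((U₀ ⟨p.src, p.μ⟩ * U₀ ⟨p.src.shift p.μ, p.ν⟩ * (U₀ ⟨p.src.shift p.ν, p.μ⟩)⁻¹ : Matrix.specialUnitaryGroup (Fin N) ℂ) : Matrix (Fin N) (Fin N) ℂ)
            - ((GaugeField.plaqHol U₀ p : Matrix.specialUnitaryGroup (Fin N) ℂ) : Matrix (Fin N) (Fin N) ℂ)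
                * ((U ⟨p.src, p.ν⟩ : Matrix (Fin N) (Fin N) ℂ) * star (U₀ ⟨p.src, p.ν⟩ : Matrix (Fin N) (Fin N) ℂ) - 1)
                * star ((GaugeField.plaqHol U₀ p : Matrix.specialUnitaryGroup (Fin N) ℂ) : Matrix (Fin N) (Fin N) ℂ))‖
      ≤ 2 * (‖(U ⟨p.src, p.μ⟩ : Matrix (Fin N) (Fin N) ℂ) * star (U₀ ⟨p.src, p.μ⟩ : Matrix (Fin N) (Fin N) ℂ) - 1‖
              + ‖(U ⟨p.src.shift p.μ, p.ν⟩ : Matrix (Fin N) (Fin N) ℂ) * star (U₀ ⟨p.src.shift p.μ, p.ν⟩ : Matrix (Fin N) (Fin N) ℂ) - 1‖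
              + ‖(U ⟨p.src.shift p.ν, p.μ⟩ : Matrix (Fin N) (Fin N) ℂ) * star (U₀ ⟨p.src.shift p.ν, p.μ⟩ : Matrix (Fin N) (Fin N) ℂ) - 1‖
              + ‖(U ⟨p.src, p.ν⟩ : Matrix (Fin N) (Fin N) ℂ) * star (U₀ ⟨p.src, p.ν⟩ : Matrix (Fin N) (Fin N) ℂ) - 1‖) ^ 2 := by
  set W₁ := U ⟨p.src, p.μ⟩ * (U₀ ⟨p.src, p.μ⟩)⁻¹ with hW₁
  set W₂ := U ⟨p.src.shift p.μ, p.ν⟩ * (U₀ ⟨p.src.shift p.μ, p.ν⟩)⁻¹ with hW₂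
  set W₃ := U ⟨p.src.shift p.ν, p.μ⟩ * (U₀ ⟨p.src.shift p.ν, p.μ⟩)⁻¹ with hW₃
  set W₄ := U ⟨p.src, p.ν⟩ * (U₀ ⟨p.src, p.ν⟩)⁻¹ with hW₄
  have hU : GaugeField.plaqHol U p
      = (W₁ * U₀ ⟨p.src, p.μ⟩) * (W₂ * U₀ ⟨p.src.shift p.μ, p.ν⟩) * (W₃ * U₀ ⟨p.src.shift p.ν, p.μ⟩)⁻¹ * (W₄ * U₀ ⟨p.src, p.ν⟩)⁻¹ := by
    rw [plaqHol_eq_word, hW₁, hW₂, hW₃, hW₄]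
    simp only [inv_mul_cancel_right]
  have hU₀ : GaugeField.plaqHol U₀ p
      = U₀ ⟨p.src, p.μ⟩ * U₀ ⟨p.src.shift p.μ, p.ν⟩ * (U₀ ⟨p.src.shift p.ν, p.μ⟩)⁻¹ * (U₀ ⟨p.src, p.ν⟩)⁻¹ := plaqHol_eq_word U₀ p
  have e₁ : (U ⟨p.src, p.μ⟩ : Matrix (Fin N) (Fin N) ℂ) * star (U₀ ⟨p.src, p.μ⟩ : Matrix (Fin N) (Fin N) ℂ) - 1 = (W₁ : Matrix (Fin N) (Fin N) ℂ) - 1 :=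
    (coe_mul_inv_sub_one _ _).symm
  have e₂ : (U ⟨p.src.shift p.μ, p.ν⟩ : Matrix (Fin N) (Fin N) ℂ) * star (U₀ ⟨p.src.shift p.μ, p.ν⟩ : Matrix (Fin N) (Fin N) ℂ) - 1
      = (W₂ : Matrix (Fin N) (Fin N) ℂ) - 1 := (coe_mul_inv_sub_one _ _).symm
  have e₃ : (U ⟨p.src.shift p.ν, p.μ⟩ : Matrix (Fin N) (Fin N) ℂ) * star (U₀ ⟨p.src.shift p.ν, p.μ⟩ : Matrix (Fin N) (Fin N) ℂ) - 1
      = (W₃ : Matrix (Fin N) (Fin N) ℂ) - 1 := (coe_mul_inv_sub_one _ _).symm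
  have e₄ : (U ⟨p.src, p.ν⟩ : Matrix (Fin N) (Fin N) ℂ) * star (U₀ ⟨p.src, p.ν⟩ : Matrix (Fin N) (Fin N) ℂ) - 1 = (W₄ : Matrix (Fin N) (Fin N) ℂ) - 1 :=
    (coe_mul_inv_sub_one _ _).symm
  rw [hU, hU₀, e₁, e₂, e₃, e₄]
  exact norm_plaq_mul_star_bg_sub_one_sub_lin_le' W₁ W₂ W₃ W₄ _ _ _ _

/-- **THE RELATIVE PLAQUETTE VARIABLE IS UNIFORMLY SMALL WHATEVER THE REPRESENTATIVE**: `‖U(∂p)U₀(∂p)^* − 1‖ ≤ dist1 U(∂p) + dist1 U₀(∂p)`. [folklore] -/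
theorem norm_relPlaq_sub_one_le (U U₀ : GaugeField P j (Matrix.specialUnitaryGroup (Fin N) ℂ)) (p : Plaq P j) :
    ‖((GaugeField.plaqHol U p : Matrix.specialUnitaryGroup (Fin N) ℂ) : Matrix (Fin N) (Fin N) ℂ)
          * star ((GaugeField.plaqHol U₀ p : Matrix.specialUnitaryGroup (Fin N) ℂ) : Matrix (Fin N) (Fin N) ℂ) - 1‖
      ≤ dist1 (GaugeField.plaqHol U p) + dist1 (GaugeField.plaqHol U₀ p) := by
  have h := GaugeGroup.dist1_mul_le (GaugeField.plaqHol U p) (GaugeField.plaqHol U₀ p)⁻¹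
  rw [GaugeGroup.dist1_inv] at h
  have e : ‖((GaugeField.plaqHol U p : Matrix.specialUnitaryGroup (Fin N) ℂ) : Matrix (Fin N) (Fin N) ℂ)
          * star ((GaugeField.plaqHol U₀ p : Matrix.specialUnitaryGroup (Fin N) ℂ) : Matrix (Fin N) (Fin N) ℂ) - 1‖
      = dist1 (GaugeField.plaqHol U p * (GaugeField.plaqHol U₀ p)⁻¹) := by
    rw [← coe_mul_inv_sub_one]; rfl
  rw [e]; exact h

/-- **THE EXACT FIRST-ORDER FUNCTIONAL AGAINST GEN 2'S LINEAR ONE, PER PLAQUETTE** (`SU(2)`): if `‖U₀(∂p) − 1‖ ≤ a` then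
`½Re Tr((U₀(∂p)−1)^*(R_p − 1)U₀(∂p)) ≥ ½Re Tr((U₀(∂p)−1)^*·L_p(Y)·U₀(∂p)) − 8a·Σ_{b∈∂p}‖Y(b)‖²`. [cite: Balaban1985Variational, (26)-(31) pp.282-283] -/
theorem half_re_trace_rel_ge_lin (U U₀ : GaugeField P j (Matrix.specialUnitaryGroup (Fin 2) ℂ)) (p : Plaq P j) {a : ℝ}
    (hE : ‖((GaugeField.plaqHol U₀ p : Matrix.specialUnitaryGroup (Fin 2) ℂ) : Matrix (Fin 2) (Fin 2) ℂ) - 1‖ ≤ a) :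
    (1 / 2) * ((((((GaugeField.plaqHol U₀ p : Matrix.specialUnitaryGroup (Fin 2) ℂ) : Matrix (Fin 2) (Fin 2) ℂ)) - 1)ᴴ
          * ((((U ⟨p.src, p.μ⟩ : Matrix (Fin 2) (Fin 2) ℂ) * star (U₀ ⟨p.src, p.μ⟩ : Matrix (Fin 2) (Fin 2) ℂ) - 1)
              + (U₀ ⟨p.src, p.μ⟩ : Matrix (Fin 2) (Fin 2) ℂ)
                  * ((U ⟨p.src.shift p.μ, p.ν⟩ : Matrix (Fin 2) (Fin 2) ℂ) * star (U₀ ⟨p.src.shift p.μ, p.ν⟩ : Matrix (Fin 2) (Fin 2) ℂ) - 1)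
                  * star (U₀ ⟨p.src, p.μ⟩ : Matrix (Fin 2) (Fin 2) ℂ)
              - ((U₀ ⟨p.src, p.μ⟩ * U₀ ⟨p.src.shift p.μ, p.ν⟩ * (U₀ ⟨p.src.shift p.ν, p.μ⟩)⁻¹ : Matrix.specialUnitaryGroup (Fin 2) ℂ) : Matrix (Fin 2) (Fin 2) ℂ)
                  * ((U ⟨p.src.shift p.ν, p.μ⟩ : Matrix (Fin 2) (Fin 2) ℂ) * star (U₀ ⟨p.src.shift p.ν, p.μ⟩ : Matrix (Fin 2) (Fin 2) ℂ) - 1)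
                  * star ((U₀ ⟨p.src, p.μ⟩ * U₀ ⟨p.src.shift p.μ, p.ν⟩ * (U₀ ⟨p.src.shift p.ν, p.μ⟩)⁻¹ : Matrix.specialUnitaryGroup (Fin 2) ℂ) : Matrix (Fin 2) (Fin 2) ℂ)
              - ((GaugeField.plaqHol U₀ p : Matrix.specialUnitaryGroup (Fin 2) ℂ) : Matrix (Fin 2) (Fin 2) ℂ)
                  * ((U ⟨p.src, p.ν⟩ : Matrix (Fin 2) (Fin 2) ℂ) * star (U₀ ⟨p.src, p.ν⟩ : Matrix (Fin 2) (Fin 2) ℂ) - 1)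
                  * star ((GaugeField.plaqHol U₀ p : Matrix.specialUnitaryGroup (Fin 2) ℂ) : Matrix (Fin 2) (Fin 2) ℂ))
            * ((GaugeField.plaqHol U₀ p : Matrix.specialUnitaryGroup (Fin 2) ℂ) : Matrix (Fin 2) (Fin 2) ℂ))).trace).re
        - 8 * a * (‖(U ⟨p.src, p.μ⟩ : Matrix (Fin 2) (Fin 2) ℂ) * star (U₀ ⟨p.src, p.μ⟩ : Matrix (Fin 2) (Fin 2) ℂ) - 1‖ ^ 2
            + ‖(U ⟨p.src.shift p.μ, p.ν⟩ : Matrix (Fin 2) (Fin 2) ℂ) * star (U₀ ⟨p.src.shift p.μ, p.ν⟩ : Matrix (Fin 2) (Fin 2) ℂ) - 1‖ ^ 2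
            + ‖(U ⟨p.src.shift p.ν, p.μ⟩ : Matrix (Fin 2) (Fin 2) ℂ) * star (U₀ ⟨p.src.shift p.ν, p.μ⟩ : Matrix (Fin 2) (Fin 2) ℂ) - 1‖ ^ 2
            + ‖(U ⟨p.src, p.ν⟩ : Matrix (Fin 2) (Fin 2) ℂ) * star (U₀ ⟨p.src, p.ν⟩ : Matrix (Fin 2) (Fin 2) ℂ) - 1‖ ^ 2)
      ≤ (1 / 2) * ((((((GaugeField.plaqHol U₀ p : Matrix.specialUnitaryGroup (Fin 2) ℂ) : Matrix (Fin 2) (Fin 2) ℂ)) - 1)ᴴ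
          * ((((GaugeField.plaqHol U p : Matrix.specialUnitaryGroup (Fin 2) ℂ) : Matrix (Fin 2) (Fin 2) ℂ)
                * star ((GaugeField.plaqHol U₀ p : Matrix.specialUnitaryGroup (Fin 2) ℂ) : Matrix (Fin 2) (Fin 2) ℂ) - 1)
            * ((GaugeField.plaqHol U₀ p : Matrix.specialUnitaryGroup (Fin 2) ℂ) : Matrix (Fin 2) (Fin 2) ℂ))).trace).re := by
  have hr := norm_plaqHol_mul_star_bg_sub_one_sub_lin_le' U U₀ p
  have hd := abs_half_re_trace_sub_le _
    (((GaugeField.plaqHol U p : Matrix.specialUnitaryGroup (Fin 2) ℂ) : Matrix (Fin 2) (Fin 2) ℂ)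
        * star ((GaugeField.plaqHol U₀ p : Matrix.specialUnitaryGroup (Fin 2) ℂ) : Matrix (Fin 2) (Fin 2) ℂ) - 1)
    (((U ⟨p.src, p.μ⟩ : Matrix (Fin 2) (Fin 2) ℂ) * star (U₀ ⟨p.src, p.μ⟩ : Matrix (Fin 2) (Fin 2) ℂ) - 1)
              + (U₀ ⟨p.src, p.μ⟩ : Matrix (Fin 2) (Fin 2) ℂ)
                  * ((U ⟨p.src.shift p.μ, p.ν⟩ : Matrix (Fin 2) (Fin 2) ℂ) * star (U₀ ⟨p.src.shift p.μ, p.ν⟩ : Matrix (Fin 2) (Fin 2) ℂ) - 1)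
                  * star (U₀ ⟨p.src, p.μ⟩ : Matrix (Fin 2) (Fin 2) ℂ)
              - ((U₀ ⟨p.src, p.μ⟩ * U₀ ⟨p.src.shift p.μ, p.ν⟩ * (U₀ ⟨p.src.shift p.ν, p.μ⟩)⁻¹ : Matrix.specialUnitaryGroup (Fin 2) ℂ) : Matrix (Fin 2) (Fin 2) ℂ)
                  * ((U ⟨p.src.shift p.ν, p.μ⟩ : Matrix (Fin 2) (Fin 2) ℂ) * star (U₀ ⟨p.src.shift p.ν, p.μ⟩ : Matrix (Fin 2) (Fin 2) ℂ) - 1)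
                  * star ((U₀ ⟨p.src, p.μ⟩ * U₀ ⟨p.src.shift p.μ, p.ν⟩ * (U₀ ⟨p.src.shift p.ν, p.μ⟩)⁻¹ : Matrix.specialUnitaryGroup (Fin 2) ℂ) : Matrix (Fin 2) (Fin 2) ℂ)
              - ((GaugeField.plaqHol U₀ p : Matrix.specialUnitaryGroup (Fin 2) ℂ) : Matrix (Fin 2) (Fin 2) ℂ)
                  * ((U ⟨p.src, p.ν⟩ : Matrix (Fin 2) (Fin 2) ℂ) * star (U₀ ⟨p.src, p.ν⟩ : Matrix (Fin 2) (Fin 2) ℂ) - 1)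
                  * star ((GaugeField.plaqHol U₀ p : Matrix.specialUnitaryGroup (Fin 2) ℂ) : Matrix (Fin 2) (Fin 2) ℂ))
    (GaugeField.plaqHol U₀ p).2.1
  set y₁ := ‖(U ⟨p.src, p.μ⟩ : Matrix (Fin 2) (Fin 2) ℂ) * star (U₀ ⟨p.src, p.μ⟩ : Matrix (Fin 2) (Fin 2) ℂ) - 1‖
  set y₂ := ‖(U ⟨p.src.shift p.μ, p.ν⟩ : Matrix (Fin 2) (Fin 2) ℂ) * star (U₀ ⟨p.src.shift p.μ, p.ν⟩ : Matrix (Fin 2) (Fin 2) ℂ) - 1‖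
  set y₃ := ‖(U ⟨p.src.shift p.ν, p.μ⟩ : Matrix (Fin 2) (Fin 2) ℂ) * star (U₀ ⟨p.src.shift p.ν, p.μ⟩ : Matrix (Fin 2) (Fin 2) ℂ) - 1‖
  set y₄ := ‖(U ⟨p.src, p.ν⟩ : Matrix (Fin 2) (Fin 2) ℂ) * star (U₀ ⟨p.src, p.ν⟩ : Matrix (Fin 2) (Fin 2) ℂ) - 1‖
  have hE0 : 0 ≤ ‖((GaugeField.plaqHol U₀ p : Matrix.specialUnitaryGroup (Fin 2) ℂ) : Matrix (Fin 2) (Fin 2) ℂ) - 1‖ := norm_nonneg _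
  have hsq : (y₁ + y₂ + y₃ + y₄) ^ 2 ≤ 4 * (y₁ ^ 2 + y₂ ^ 2 + y₃ ^ 2 + y₄ ^ 2) := by
    nlinarith [sq_nonneg (y₁ - y₂), sq_nonneg (y₁ - y₃), sq_nonneg (y₁ - y₄), sq_nonneg (y₂ - y₃), sq_nonneg (y₂ - y₄), sq_nonneg (y₃ - y₄)]
  have hprod := mul_le_mul hE (hr.trans (mul_le_mul_of_nonneg_left hsq (by norm_num))) (norm_nonneg _) (hE0.trans hE)
  have := (abs_le.mp (hd.trans hprod)).1
  linarith

end Lattice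

end Summit.QuantumFields.YangMills.Theorems.Prop7ExactExpansion

end
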